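import Literature.AnabelianGeometry.EtaleTheta.Discharge.Sec5TransportsHYddOfConnectedTemperoid
import Literature.AnabelianGeometry.EtaleTheta.Discharge.Sec5AodotCharacteristicOfTemperoid
import Literature.AlgebraicGeometry.Frobenioids.EquivalenceUnitsTransport

/-!
# [EtTh] Thm. 5.7 / Thm. 5.10 (i) at the genuine §5 data: the named inputs «`Ψ` preserves Frobenius-trivial objects»
# (`hΨFT`) and «`Ψ(A_N)^bs ≅ A_N^bs`» (`hbs`) PRODUCED (pp. 329, 333 / PDF pp. 103, 107)

S. Mochizuki, *The étale theta function and its Frobenioid-theoretic manifestations*, Publ. RIMS **45** (2009)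
[MochizukiEtTh2009], proof of Thm. 5.6/5.7 p.329 (PDF p.103) l.5–9 («`Ψ(A_1)^bs ≅ A_1^bs` … `Ψ` preserves
Frobenius-trivial objects [cf. [FrdI], Theorem 3.4]»), Thm. 5.10 (i) p.333 (PDF p.107); S. Mochizuki, *The geometry of
Frobenioids I*, Kyushu J. Math. **62** (2008) [MochizukiFrdI2008], Thm. 3.4 (iii), (v) pp.62–63, Def. 1.2 (iv) p.22;
*Semi-graphs of anabelioids* [MochizukiSemiAnbd2006], Prop. 3.2 p.35.

abc-iut cell, layer L2, seat abc-iut-w5-d013 (gen 5), ROW «hΨFT + hbs PRODUCERS AT THE GENUINE §5 DATA» (STATUS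
2026-08-26T12:33Z).  PROOF-ONLY (no definition, no new named fact); nothing landed is edited or restated.

THE BINDERS.  abc-iut-w5-d245's `ThetaFrobenioid.exists_seeds_hdivcapcup_ofConnectedTemperoidData` (Thm. 5.7 final knit /
Thm. 5.10 (i), `Discharge/Sec5SeedsOfDivTransport.lean`) and abc-iut-L2-d4's `preservesIsoClasses_of_model`
(`Discharge/Sec5ModelCase.lean`) take, among their named inputs,
* `hΨFT : PreFrobenioidData.PreservesObj Ψ.functor 𝔉.pre.IsFrobeniusTrivial 𝔉.pre.IsFrobeniusTrivial` — «`Ψ` preserves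
  Frobenius-trivial objects» ([FrdI] Thm. 3.4), and
* `hbs : 𝔉.pre.BaseIsomorphic (Ψ.functor.obj 𝔉.AN) 𝔉.AN` — «`Ψ(A_N)^bs ≅ A_N^bs`» (characteristic, Prop. 2.4 class).
This file PROVES both at abc-iut-L2-t4's assembled §5 data `𝔉 := ThetaFrobenioid.ofBiKummerData …` over any base `D` of
FSM-type and slim (`hΨFT`), resp. at the genuine data `𝔉 := ofConnectedTemperoidData …` over `D := B^temp(Π^tp_X)⁰ =
ConnectedPart (BTemp X.Pi)` (both), from theorems of the tree consumed BY NAME: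
* [FrdI] Thm. 3.4 (iii) for Frobenioids over FSM-type bases (abc-iut-w4-d033's `FrdI.thm34iii_morphisms_of_isOfFSMType`):
  `Ψ` preserves morphisms of Frobenius type and base-isomorphisms, and acts on Frobenius degrees through `Ψ^{ℕ≥1}`;
* [FrdI] Thm. 3.4 (v) (abc-iut-L1-d4's `PreFrobenioid.psiBase` / `psiBaseSquare` / `psiBase_isEquivalence`, with
  `baseEquivalent_map_of_isSlim` and abc-iut-L2-d4's `isIso_base_map_of_isPreStep_model`): the 1-compatible equivalence
  `Ψ^bs : D ⥲ D` with `eΨ : Ψ ⋙ Base ≅ Base ⋙ Ψ^bs` — exactly as already exposed by abc-iut-w5-d245's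
  `exists_psiBaseTransportData_ofBiKummerData`;
* abc-iut-L1's transport lemma `isFrobeniusTrivial_map_of_square` ([FrdI] Cor. 5.7 proof: transport the section
  `ζ : ℕ≥1 → End(A)` as `Ψ ∘ ζ ∘ (Ψ^{ℕ≥1})⁻¹`) ⇒ **`hΨFT`** (`preservesObj_isFrobeniusTrivial_of_model`,
  `hΨFT_ofBiKummerData`, `hΨFT_ofConnectedTemperoidData`);
* abc-iut-w4-d008's `GaloisObjects.nonempty_iso_of_connectedPart_equivalence_of_isTopCharacteristic` ([SemiAnbd] Prop. 3.2
  via this seat's gen-3/4 `BTemp.exists_equivalence_extension` / `exists_res_iso_of_equivalence`): a self-equivalence of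
  `B^temp(Π)⁰` fixes, up to isomorphism, a Galois object whose kernel `Ker(Π ↠ Aut(−))` is characteristic in the
  topological group `Π` ⇒ with `eΨ`: **`hbs`** from the ONE anabelian clause `IsTopCharacteristic X.Pi
  (Ker(Π^tp_X ↠ Aut_D(A_N^bs)))` ([EtTh] Prop. 2.4 class — the same residual class as the §4-setting binder `hchar`
  of abc-iut-w4-d008's `Sec5AodotCharacteristicOfTemperoid.lean`) (`baseIsomorphic_map_of_isTopCharacteristic`,
  `hbs_ofConnectedTemperoidData`).
v3 (same row): + `BiKummerSetting.exists_baseEquivalence_compat_mkOfConnectedTemperoid` — the binder `hΨbs` («`Ψ` induces `Ψ^bs`», [FrdI]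
Thm. 3.4 (v)) of abc-iut-w4-d008's `exists_thm44Hyp_mkOfConnectedTemperoidYddTower` PRODUCED over `B^temp(Π^tp_X)⁰` in its shape.
v2 (same row): + `preservesIsoClasses_ofConnectedTemperoidData` — abc-iut-L2-d4's [EtTh] Thm. 5.10 (i) model-case closer AT THE
GENUINE DATA with `hFT`/`hΨFT`/`hbs` discharged (residual {`hc`, `hdiv`} + model hypotheses).
NET EFFECT on the residual of `EtTh:Thm5.7` / `EtTh:Thm5.10(i)` at the genuine data: {`hΨFT`, `hbs`, `hdivA`} ↦
{`IsTopCharacteristic` of `A_N^bs` (Prop. 2.4 class), `hdivA` (GAP G-w5d245-2)}.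
HONEST FRAMING: kernel-checked category theory over the tree's [FrdI]/[SemiAnbd] vocabulary; the anabelian content
(«`A_N^bs` is characteristic») stays a NAMED HYPOTHESIS; [EtTh]/[FrdI]/[SemiAnbd] are refereed pre-IUT material; nothing
here bears on [IUTchIII] Cor. 3.12 — no side is taken; typed ≠ proved for the genuine data.
-/

-- `(PreFrobenioidData.ofFunctor Φ F).base` is `baseFunctor F` only at default transparency (as in abc-iut-L1's files).
set_option backward.isDefEq.respectTransparency false

noncomputable section

namespace Literature.AnabelianGeometry.EtaleTheta

open CategoryTheory Opposite Literature.AlgebraicGeometry.Frobenioids Literature.AnabelianGeometry.SemiGraphs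
  Literature.AnabelianGeometry.SemiGraphs.GaloisObjects

namespace BiKummerSetting

universe u₀ v₀ u v w

/-! ### 1. «`Ψ` preserves Frobenius-trivial objects» for the setting's tempered Frobenioid ([FrdI] Thm. 3.4 (iii), (v)) -/

section General

variable {K : Type u₀} [Field K]
  {X : SemiGraphs.TemperedArithmeticGroup.{u₀} K} {D₀ : Type u₀} [Category.{v₀} D₀]
  {V : FrdIMonoidStub.{w}} {T₀ : RealifiedDivisorMonoids (D₀ := D₀) V} {D : Type u} [Category.{v} D]
  {VD : FrdICatStub.{u, v, w} D} (S : BiKummerSetting X T₀ D VD)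
  (h : ModelFrobenioid.Hypotheses S.tf.divisorMonoid S.tf.ratFnFunctor)

include h in
/-- **The 1-compatible `Ψ^bs` of [FrdI] Thm. 3.4 (v) together with the Thm. 3.4 (iii) clauses «Frobenius type preserved»
and `deg_Fr(Ψ φ) = Ψ^{ℕ≥1}(deg_Fr φ)`**, for a self-equivalence `Ψ` of the setting's tempered Frobenioid over a slim base of
FSM-type with `Φ` non-dilating and a non-group-like object (the model hypotheses of abc-iut-w5-d245's
`exists_psiBaseTransportData_ofBiKummerData`, whose first half this is — no root datum / identification `α` needed).
[cite: MochizukiFrdI2008, Thm. 3.4 (v) p.63] -/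
theorem exists_psiBase_frobeniusType_degFr (hD : IsOfFSMType D) (hslim : IsSlim D)
    (hnd : IsNonDilatingOn S.tf.divisorMonoid)
    (hN : ∃ A : S.C, ¬ (PreFrobenioidData.ofModel S.tf.divisorMonoid S.tf.ratFnFunctor S.tf.divBNatTrans).IsGroupLikeObj A)
    (Ψ : S.C ≌ S.C) :
    ∃ (Ψbs : D ⥤ D) (_ : Ψbs.IsEquivalence)
      (_ : Ψ.functor ⋙ PreFrobenioid.baseFunctor S.F ≅ PreFrobenioid.baseFunctor S.F ⋙ Ψbs) (ΨN : ℕ+ ≃* ℕ+),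
      PreFrobenioidData.PreservesMor Ψ.functor
          (PreFrobenioidData.ofFunctor S.tf.divisorMonoid S.F).IsFrobeniusType
          (PreFrobenioidData.ofFunctor S.tf.divisorMonoid S.F).IsFrobeniusType ∧
        ∀ ⦃A B : S.C⦄ (φ : A ⟶ B), PreFrobenioid.degFr S.F (Ψ.functor.map φ) = ΨN (PreFrobenioid.degFr S.F φ) := by
  have hF : PreFrobenioid.IsFrobenioid S.F :=
    ModelFrobenioid.isFrobenioid (DivB := S.tf.divBNatTrans) h.isMonoidOn h.isDivisorial h.isMonoidOn_rat
      h.isGroupLike_rat h.isGraphConnected h.isTotallyEpimorphic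
  -- [FrdI] Thm. 3.4 (iii): the seven preservation clauses and `Ψ^{ℕ≥1}`, for `Ψ` and `Ψ⁻¹`
  have hq := ModelFrobenioid.data_isOfQuasiIsotropicType (DivB := S.tf.divBNatTrans) h
  have hnd' : (ModelFrobenioid.data S.tf.divisorMonoid S.tf.ratFnFunctor S.tf.divBNatTrans).IsNonDilatingOn :=
    (ModelFrobenioid.data_isNonDilatingOn_iff S.tf.divisorMonoid S.tf.ratFnFunctor S.tf.divBNatTrans).mpr hnd
  obtain ⟨hlist, ΨN, hN', -⟩ := FrdI.thm34iii_morphisms_of_isOfFSMType hF hF hq hq hD hD hnd' hnd' Ψ hN hN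
  obtain ⟨hlist', -⟩ := FrdI.thm34iii_morphisms_of_isOfFSMType hF hF hq hq hD hD hnd' hnd' Ψ.symm hN hN
  -- [FrdI] Thm. 3.4 (v), first sentence (slim base): `Ψ`, `Ψ⁻¹` preserve base-equivalent pairs; Thm. 3.4 (ii): pre-steps ↦ base-isos
  have hbeF : ∀ ⦃A B : S.C⦄ (φ ψ : A ⟶ B), PreFrobenioid.BaseEquivalent S.F φ ψ →
      PreFrobenioid.BaseEquivalent S.F (Ψ.functor.map φ) (Ψ.functor.map ψ) := fun A B φ ψ hφψ =>
    PreFrobenioid.baseEquivalent_map_of_isSlim hF hF Ψ hslim (fun X Y f hf => hlist.2.2.1 f hf) hφψ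
  have hbeF' : ∀ ⦃A B : S.C⦄ (φ ψ : A ⟶ B), PreFrobenioid.BaseEquivalent S.F φ ψ →
      PreFrobenioid.BaseEquivalent S.F (Ψ.inverse.map φ) (Ψ.inverse.map ψ) := fun A B φ ψ hφψ =>
    PreFrobenioid.baseEquivalent_map_of_isSlim hF hF Ψ.symm hslim (fun X Y f hf => hlist'.2.2.1 f hf) hφψ
  have hbi := ThetaFrobenioid.isIso_base_map_of_isPreStep_model (DivB := S.tf.divBNatTrans) Ψ h hD
  have hbi' : ∀ ⦃Y A : S.C⦄ (a : Y ⟶ A), PreFrobenioid.IsPreStep S.F a →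
      IsIso (PreFrobenioid.Base S.F (Ψ.inverse.map a)) :=
    ThetaFrobenioid.isIso_base_map_of_isPreStep_model (DivB := S.tf.divBNatTrans) Ψ.symm h hD
  haveI := PreFrobenioid.psiBase_isEquivalence hF hF Ψ hbi hbeF hbi' hbeF'
  exact ⟨PreFrobenioid.psiBase hF Ψ.functor hbi hbeF, inferInstance, PreFrobenioid.psiBaseSquare hF Ψ.functor hbi hbeF, ΨN,
    hlist.1, hN'⟩

include h in
/-- **«`Ψ` preserves Frobenius-trivial objects»** ([EtTh] p.329 l.9 «[cf. [FrdI], Theorem 3.4]»; [FrdI] Def. 1.2 (iv)) for every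
self-equivalence `Ψ` of the setting's tempered Frobenioid over a slim base of FSM-type (`Φ` non-dilating, a non-group-like
object): transport the section `ζ : ℕ≥1 → End(A)` along `Ψ` over the 1-compatible `Ψ^bs` (abc-iut-L1's
`isFrobeniusTrivial_map_of_square`).  Stated for the operations `PreFrobenioidData.ofModel …` (= `𝔉.pre` of every §5 datum
`ofBiKummerData …`, rfl).  [cite: MochizukiEtTh2009, Thm 5.6 proof p.329 (PDF p.103)] -/
theorem preservesObj_isFrobeniusTrivial_of_model (hD : IsOfFSMType D) (hslim : IsSlim D)
    (hnd : IsNonDilatingOn S.tf.divisorMonoid)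
    (hN : ∃ A : S.C, ¬ (PreFrobenioidData.ofModel S.tf.divisorMonoid S.tf.ratFnFunctor S.tf.divBNatTrans).IsGroupLikeObj A)
    (Ψ : S.C ≌ S.C) :
    PreFrobenioidData.PreservesObj Ψ.functor
      (PreFrobenioidData.ofModel S.tf.divisorMonoid S.tf.ratFnFunctor S.tf.divBNatTrans).IsFrobeniusTrivial
      (PreFrobenioidData.ofModel S.tf.divisorMonoid S.tf.ratFnFunctor S.tf.divBNatTrans).IsFrobeniusTrivial := by
  obtain ⟨Ψbs, hΨbs, eΨ, ΨN, hft, hN'⟩ := S.exists_psiBase_frobeniusType_degFr h hD hslim hnd hN Ψ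
  intro A hA
  exact (PreFrobenioidData.ofFunctor_isFrobeniusTrivial _ _).mpr
    (PreFrobenioid.isFrobeniusTrivial_map_of_square S.F S.F Ψ Ψbs eΨ hft ΨN hN'
      ((PreFrobenioidData.ofFunctor_isFrobeniusTrivial _ _).mp hA))

include h in
/-- The same in the `PreFrobenioid` vocabulary of the setting (`S.IsFrobeniusTrivial = PreFrobenioid.IsFrobeniusTrivial S.F`).
[cite: MochizukiFrdI2008, Thm. 3.4 (iii) p.62] -/
theorem isFrobeniusTrivial_map_of_model (hD : IsOfFSMType D) (hslim : IsSlim D)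
    (hnd : IsNonDilatingOn S.tf.divisorMonoid)
    (hN : ∃ A : S.C, ¬ (PreFrobenioidData.ofModel S.tf.divisorMonoid S.tf.ratFnFunctor S.tf.divBNatTrans).IsGroupLikeObj A)
    (Ψ : S.C ≌ S.C) {A : S.C} (hA : S.IsFrobeniusTrivial A) : S.IsFrobeniusTrivial (Ψ.functor.obj A) := by
  obtain ⟨Ψbs, hΨbs, eΨ, ΨN, hft, hN'⟩ := S.exists_psiBase_frobeniusType_degFr h hD hslim hnd hN Ψ
  exact PreFrobenioid.isFrobeniusTrivial_map_of_square S.F S.F Ψ Ψbs eΨ hft ΨN hN' hA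

end General

/-! ### 1b. The binder `hΨbs` («`Ψ` induces a 1-compatible `Ψ^bs`», [FrdI] Thm. 3.4 (v)) over `B^temp(Π^tp_X)⁰` (v3, same row) -/

section ConnectedBase

variable {K : Type u₀} [Field K] (X : SemiGraphs.TemperedArithmeticGroup.{u₀} K) {D₀ : Type u₀} [Category.{v₀} D₀]
  {V : FrdIMonoidStub.{w}} {T₀ : RealifiedDivisorMonoids (D₀ := D₀) V}
  {VD : FrdICatStub.{u₀ + 1, u₀, w} (ConnectedPart (BTemp X.Pi))}
  (tf : TemperedFrobenioid T₀ (ConnectedPart (BTemp X.Pi)) VD) (hZ : tf.monoidType = MonoidType.Z)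
  (hP : ∀ A : (ConnectedPart (BTemp X.Pi))ᵒᵖ, IsPerfect (tf.Φ.carrier A))
  (NH : Subgroup (Field.absoluteGaloisGroup K) → tf.category → ℕ+ → Prop) (A₀ : tf.category)
  (hA₀ : PreFrobenioid.IsFrobeniusTrivial tf.toElem A₀) (hA₀' : SemiGraphs.IsGaloisObj A₀.base.obj)
  (h : ModelFrobenioid.Hypotheses tf.divisorMonoid tf.ratFnFunctor)

include h in
/-- **The binder `hΨbs` of abc-iut-w4-d008's `exists_thm44Hyp_mkOfConnectedTemperoidYddTower` (p446962) / abc-iut-L2-t9's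
`exists_thm44Hyp_self_of_characteristic` — «`Ψ` induces a 1-compatible equivalence `Ψ^bs : D ⥲ D`» ([EtTh] Thm. 4.4 (i) ← [FrdI] Thm. 3.4 (v))
— PRODUCED over `B^temp(Π^tp_X)⁰` for EVERY self-equivalence `Ψ` of the tempered Frobenioid, in that binder's shape
`∃ Ψbs : D ≌ D, Nonempty (Base ⋙ Ψbs ≅ Ψ ⋙ Base)`: abc-iut-L1-d4's `psiBase` (`exists_psiBase_frobeniusType_degFr`; base of FSM-type and
slim are theorems for the connected temperoid).  Residual model hypotheses: `Φ` non-dilating, a non-group-like object.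
[cite: MochizukiEtTh2009, Thm 4.4 (i) p.320 (PDF p.94)] [cite: MochizukiFrdI2008, Thm. 3.4 (v) p.63] -/
theorem exists_baseEquivalence_compat_mkOfConnectedTemperoid (hnd : IsNonDilatingOn tf.divisorMonoid)
    (hN : ∃ A : (mkOfConnectedTemperoid X tf hZ hP NH A₀ hA₀ hA₀').C,
      ¬ (PreFrobenioidData.ofModel tf.divisorMonoid tf.ratFnFunctor tf.divBNatTrans).IsGroupLikeObj A)
    (Ψ : (mkOfConnectedTemperoid X tf hZ hP NH A₀ hA₀ hA₀').C ≌ (mkOfConnectedTemperoid X tf hZ hP NH A₀ hA₀ hA₀').C) :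
    ∃ Ψbs : ConnectedPart (BTemp X.Pi) ≌ ConnectedPart (BTemp X.Pi),
      Nonempty ((mkOfConnectedTemperoid X tf hZ hP NH A₀ hA₀ hA₀').base ⋙ Ψbs.functor ≅
        Ψ.functor ⋙ (mkOfConnectedTemperoid X tf hZ hP NH A₀ hA₀ hA₀').base) := by
  obtain ⟨Ψbs, hΨbs, eΨ, -, -, -⟩ :=
    (mkOfConnectedTemperoid X tf hZ hP NH A₀ hA₀ hA₀').exists_psiBase_frobeniusType_degFr h
      QuasiTemperoid.BTempConnected.connectedPart_isOfFSMType (TemperedArithmeticGroup.isSlim_connectedPart X) hnd hN Ψ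
  exact ⟨Ψbs.asEquivalence, ⟨eΨ.symm⟩⟩

end ConnectedBase

end BiKummerSetting

namespace ThetaFrobenioid

universe u₀ v₀ u v w

/-! ### 2. `hΨFT` at abc-iut-L2-t4's assembled §5 data `ofBiKummerData` (any slim FSM-type base) -/

section OfBiKummerData

variable {K : Type u₀} [Field K]
  {X : SemiGraphs.TemperedArithmeticGroup.{u₀} K} {D₀ : Type u₀} [Category.{v₀} D₀]
  {V : FrdIMonoidStub.{w}} {T₀ : RealifiedDivisorMonoids (D₀ := D₀) V} {D : Type u} [Category.{v} D]
  {VD : FrdICatStub.{u, v, w} D} {S : BiKummerSetting X T₀ D VD}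
  {pullFrac : ∀ {A A' : S.C} (_ : A' ⟶ A), S.biratUnits A → S.biratUnits A'}
  {lv N : ℕ+} {T : ThetaEnvData.{max v w} N} {θr : S.biratUnits S.Aodot} {Bl : S.C}
  {Pl : S.FractionPair θr Bl} {Rl : S.NthRoot θr Pl lv pullFrac}
  (h : ModelFrobenioid.Hypotheses S.tf.divisorMonoid S.tf.ratFnFunctor)
  (toB : ∀ A : S.C, S.biratUnits A →* S.tf.biratUnitsModel A)
  (Q : FrobenioidTheta.ThetaSubquotientStub.{w} D) (odd_l : Odd (lv : ℕ)) (R : S.NthRoot Rl.root Rl.pair N pullFrac)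
  (ιX : T.PiX ≃ₜ* X.Pi) (hopen : IsOpen ((S.galoisSurj R.AN.base R.αData.isGalois).ker : Set X.Pi))
  (σ : Aut R.AN.base →* Aut R.AN) (K' : Type w) [Field K'] (constEmb : K'ˣ →* S.tf.biratUnitsModel R.BN)
  (constEmb_injective : Function.Injective constEmb)
  (hdivc : ∀ g : Aut R.BN.base,
    ModelFrobenioid.div ((σ ((BiKummerSetting.NthRoot.baseIso S R).conjAut.symm g)).hom ≫ R.pair.num) =
      ModelFrobenioid.div R.pair.num)
  (hdivp : ∀ y : T.PiYdd,
    ModelFrobenioid.div ((σ (S.galoisSurj R.AN.base R.αData.isGalois (ιX y.1))).hom ≫ R.pair.den) =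
      ModelFrobenioid.div R.pair.den)

include h in
/-- **`hΨFT` at `𝔉 := ofBiKummerData …`** — «`Ψ` preserves Frobenius-trivial objects», in abc-iut-w5-d245's / abc-iut-L2-d4's binder
shape `PreFrobenioidData.PreservesObj Ψ.functor 𝔉.pre.IsFrobeniusTrivial 𝔉.pre.IsFrobeniusTrivial`, for every self-equivalence `Ψ`,
over a slim base of FSM-type (`Φ` non-dilating, a non-group-like object).  [cite: MochizukiEtTh2009, Thm 5.6 proof p.329 (PDF p.103)] -/
theorem hΨFT_ofBiKummerData (hD : IsOfFSMType D) (hslim : IsSlim D) (hnd : IsNonDilatingOn S.tf.divisorMonoid)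
    (hN : ∃ A : S.C, ¬ (PreFrobenioidData.ofModel S.tf.divisorMonoid S.tf.ratFnFunctor S.tf.divBNatTrans).IsGroupLikeObj A)
    (Ψ : S.C ≌ S.C) :
    PreFrobenioidData.PreservesObj Ψ.functor
      (ofBiKummerData h toB Q odd_l R ιX hopen σ K' constEmb constEmb_injective hdivc hdivp).pre.IsFrobeniusTrivial
      (ofBiKummerData h toB Q odd_l R ιX hopen σ K' constEmb constEmb_injective hdivc hdivp).pre.IsFrobeniusTrivial :=
  S.preservesObj_isFrobeniusTrivial_of_model h hD hslim hnd hN Ψ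

end OfBiKummerData

/-! ### 3. `hΨFT` and `hbs` at the genuine §5 data over `B^temp(Π^tp_X)⁰` -/

section ConnectedTemperoidData

variable {K : Type u₀} [Field K] {X : SemiGraphs.TemperedArithmeticGroup.{u₀} K} {D₀ : Type u₀} [Category.{v₀} D₀]
  {V : FrdIMonoidStub.{w}} {T₀ : RealifiedDivisorMonoids (D₀ := D₀) V}
  {VD : FrdICatStub.{u₀ + 1, u₀, w} (ConnectedPart (BTemp X.Pi))}
  {tf : TemperedFrobenioid T₀ (ConnectedPart (BTemp X.Pi)) VD} {hZ : tf.monoidType = MonoidType.Z}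
  {hP : ∀ A : (ConnectedPart (BTemp X.Pi))ᵒᵖ, IsPerfect (tf.Φ.carrier A)}
  {NH : Subgroup (Field.absoluteGaloisGroup K) → tf.category → ℕ+ → Prop} {A₀ : tf.category}
  {hA₀ : PreFrobenioid.IsFrobeniusTrivial tf.toElem A₀} {hA₀' : SemiGraphs.IsGaloisObj A₀.base.obj}
  {pullFrac : ∀ {A A' : (BiKummerSetting.mkOfConnectedTemperoid X tf hZ hP NH A₀ hA₀ hA₀').C} (_ : A' ⟶ A),
    (BiKummerSetting.mkOfConnectedTemperoid X tf hZ hP NH A₀ hA₀ hA₀').biratUnits A →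
      (BiKummerSetting.mkOfConnectedTemperoid X tf hZ hP NH A₀ hA₀ hA₀').biratUnits A'}
  {lv N : ℕ+} {T : ThetaEnvData.{max u₀ w} N}
  {θ : (BiKummerSetting.mkOfConnectedTemperoid X tf hZ hP NH A₀ hA₀ hA₀').biratUnits
    (BiKummerSetting.mkOfConnectedTemperoid X tf hZ hP NH A₀ hA₀ hA₀').Aodot}
  {Bl : (BiKummerSetting.mkOfConnectedTemperoid X tf hZ hP NH A₀ hA₀ hA₀').C}
  {Pl : (BiKummerSetting.mkOfConnectedTemperoid X tf hZ hP NH A₀ hA₀ hA₀').FractionPair θ Bl}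
  {Rl : (BiKummerSetting.mkOfConnectedTemperoid X tf hZ hP NH A₀ hA₀ hA₀').NthRoot θ Pl lv pullFrac}
  (h : ModelFrobenioid.Hypotheses tf.divisorMonoid tf.ratFnFunctor)
  (Q : FrobenioidTheta.ThetaSubquotientStub.{w} (ConnectedPart (BTemp X.Pi))) (odd_l : Odd (lv : ℕ))
  (R : (BiKummerSetting.mkOfConnectedTemperoid X tf hZ hP NH A₀ hA₀ hA₀').NthRoot Rl.root Rl.pair N pullFrac)
  (ιX : T.PiX ≃ₜ* X.Pi) (K' : Type w) [Field K'] (constEmb : K'ˣ →* tf.biratUnitsModel R.BN)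
  (constEmb_injective : Function.Injective constEmb)
  (hinvc : ∀ g : Aut R.AN.base,
    pull tf.divisorMonoid g.hom (ModelFrobenioid.div R.pair.num) = ModelFrobenioid.div R.pair.num)
  (hinvp : ∀ y : T.PiX, y ∈ T.PiYdd →
    pull tf.divisorMonoid ((BiKummerSetting.mkOfConnectedTemperoid X tf hZ hP NH A₀ hA₀ hA₀').galoisSurj R.AN.base
      R.αData.isGalois (ιX y)).hom (ModelFrobenioid.div R.pair.den) = ModelFrobenioid.div R.pair.den)

include h in
/-- **`hΨFT` at the genuine §5 data `𝔉 := ofConnectedTemperoidData …`** — «`Ψ` preserves Frobenius-trivial objects» for EVERY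
self-equivalence `Ψ`, with the base hypotheses «`B^temp(Π^tp_X)⁰` of FSM-type» ([FrdII] Ex. 1.3,
`QuasiTemperoid.BTempConnected.connectedPart_isOfFSMType`) and «slim» ([SemiAnbd] Rmk. 3.4.1,
`TemperedArithmeticGroup.isSlim_connectedPart`) THEOREMS; residual model hypotheses: `Φ` non-dilating (Thm. 3.7 (i) input) and a
non-group-like object.  Binder shape = abc-iut-w5-d245's `hΨFT` verbatim.  [cite: MochizukiEtTh2009, Thm 5.6 proof p.329 (PDF p.103)] -/
theorem hΨFT_ofConnectedTemperoidData (hnd : IsNonDilatingOn tf.divisorMonoid)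
    (hN : ∃ A : (BiKummerSetting.mkOfConnectedTemperoid X tf hZ hP NH A₀ hA₀ hA₀').C,
      ¬ (PreFrobenioidData.ofModel tf.divisorMonoid tf.ratFnFunctor tf.divBNatTrans).IsGroupLikeObj A)
    (Ψ : (BiKummerSetting.mkOfConnectedTemperoid X tf hZ hP NH A₀ hA₀ hA₀').C ≌
      (BiKummerSetting.mkOfConnectedTemperoid X tf hZ hP NH A₀ hA₀ hA₀').C) :
    PreFrobenioidData.PreservesObj Ψ.functor
      (ofConnectedTemperoidData h Q odd_l R ιX K' constEmb constEmb_injective hinvc hinvp).pre.IsFrobeniusTrivial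
      (ofConnectedTemperoidData h Q odd_l R ιX K' constEmb constEmb_injective hinvc hinvp).pre.IsFrobeniusTrivial :=
  (BiKummerSetting.mkOfConnectedTemperoid X tf hZ hP NH A₀ hA₀ hA₀').preservesObj_isFrobeniusTrivial_of_model h
    QuasiTemperoid.BTempConnected.connectedPart_isOfFSMType (TemperedArithmeticGroup.isSlim_connectedPart X) hnd hN Ψ

include h in
/-- **`Ψ(A)^bs ≅ A^bs` for every object `A` whose base is a Galois object with CHARACTERISTIC kernel** ([EtTh] p.329 l.5
«characteristic»; Prop. 2.4 class): for every self-equivalence `Ψ` of the tempered Frobenioid over `B^temp(Π^tp_X)⁰` (model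
hypotheses as in `hΨFT_ofConnectedTemperoidData`), `Ψ(A)^bs ≅ Ψ^bs(A^bs)` by the 1-compatible square of [FrdI] Thm. 3.4 (v)
(`exists_psiBase_frobeniusType_degFr`), and `Ψ^bs(A^bs) ≅ A^bs` by abc-iut-w4-d008's
`GaloisObjects.nonempty_iso_of_connectedPart_equivalence_of_isTopCharacteristic` ([SemiAnbd] Prop. 3.2).
[cite: MochizukiEtTh2009, Thm 5.6 proof p.329 (PDF p.103)] -/
theorem baseIsomorphic_map_of_isTopCharacteristic (hnd : IsNonDilatingOn tf.divisorMonoid)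
    (hN : ∃ A : (BiKummerSetting.mkOfConnectedTemperoid X tf hZ hP NH A₀ hA₀ hA₀').C,
      ¬ (PreFrobenioidData.ofModel tf.divisorMonoid tf.ratFnFunctor tf.divBNatTrans).IsGroupLikeObj A)
    (Ψ : (BiKummerSetting.mkOfConnectedTemperoid X tf hZ hP NH A₀ hA₀ hA₀').C ≌
      (BiKummerSetting.mkOfConnectedTemperoid X tf hZ hP NH A₀ hA₀ hA₀').C)
    (A : (BiKummerSetting.mkOfConnectedTemperoid X tf hZ hP NH A₀ hA₀ hA₀').C) (hA : SemiGraphs.IsGaloisObj A.base.obj)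
    (hc : IsTopCharacteristic X.Pi (galoisSurjOf X.isTempered A.base.obj hA).ker) :
    Nonempty ((Ψ.functor.obj A).base ≅ A.base) := by
  haveI := X.secondCountableTopology
  obtain ⟨Ψbs, hΨbs, eΨ, -, -, -⟩ :=
    (BiKummerSetting.mkOfConnectedTemperoid X tf hZ hP NH A₀ hA₀ hA₀').exists_psiBase_frobeniusType_degFr h
      QuasiTemperoid.BTempConnected.connectedPart_isOfFSMType (TemperedArithmeticGroup.isSlim_connectedPart X) hnd hN Ψ
  -- `Ψ^bs(A^bs) ≅ A^bs` ([SemiAnbd] Prop. 3.2 + characteristic kernel)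
  obtain ⟨i⟩ := nonempty_iso_of_connectedPart_equivalence_of_isTopCharacteristic X.isTempered Ψbs.asEquivalence A.base hA hc
  -- `Ψ(A)^bs ≅ Ψ^bs(A^bs)` (the 1-compatible square)
  exact ⟨eΨ.app A ≪≫ i⟩

include h in
/-- **`hbs` at the genuine §5 data `𝔉 := ofConnectedTemperoidData …`** — «`Ψ(A_N)^bs ≅ A_N^bs`» in abc-iut-w5-d245's binder shape
`𝔉.pre.BaseIsomorphic (Ψ.functor.obj 𝔉.AN) 𝔉.AN`, for EVERY self-equivalence `Ψ`, from the ONE anabelian clause «the kernel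
`Ker(Π^tp_X ↠ Aut_D(A_N^bs))` of the Galois object `A_N^bs` is characteristic in the topological group `Π^tp_X`» ([EtTh] Prop. 2.4
class; `A_N^bs` is Galois by the root datum, `NthRoot.αData.isGalois`; the setting's Galois surjection has the kernel of
`galoisSurjOf`, abc-iut-L2-t4's `ker_mkOfConnectedTemperoid_galoisSurj`).  [cite: MochizukiEtTh2009, Thm 5.6 proof p.329 (PDF p.103)] -/
theorem hbs_ofConnectedTemperoidData (hnd : IsNonDilatingOn tf.divisorMonoid)
    (hN : ∃ A : (BiKummerSetting.mkOfConnectedTemperoid X tf hZ hP NH A₀ hA₀ hA₀').C,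
      ¬ (PreFrobenioidData.ofModel tf.divisorMonoid tf.ratFnFunctor tf.divBNatTrans).IsGroupLikeObj A)
    (hc : IsTopCharacteristic X.Pi
      ((BiKummerSetting.mkOfConnectedTemperoid X tf hZ hP NH A₀ hA₀ hA₀').galoisSurj R.AN.base R.αData.isGalois).ker)
    (Ψ : (BiKummerSetting.mkOfConnectedTemperoid X tf hZ hP NH A₀ hA₀ hA₀').C ≌
      (BiKummerSetting.mkOfConnectedTemperoid X tf hZ hP NH A₀ hA₀ hA₀').C) :
    (ofConnectedTemperoidData h Q odd_l R ιX K' constEmb constEmb_injective hinvc hinvp).pre.BaseIsomorphic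
      (Ψ.functor.obj (ofConnectedTemperoidData h Q odd_l R ιX K' constEmb constEmb_injective hinvc hinvp).AN)
      (ofConnectedTemperoidData h Q odd_l R ιX K' constEmb constEmb_injective hinvc hinvp).AN := by
  rw [BiKummerSetting.ker_mkOfConnectedTemperoid_galoisSurj] at hc
  exact baseIsomorphic_map_of_isTopCharacteristic h hnd hN Ψ R.AN R.αData.isGalois hc

include h in
/-- **[EtTh] Thm. 5.10 (i) at the genuine §5 data `𝔉 := ofConnectedTemperoidData …`** — `𝔉.PreservesIsoClasses Ψ` («`Ψ`
preserves the isomorphism classes of the `N`-th roots», abc-iut-L2-d4's Thm. 5.10 (i) predicate of `Discharge/Sec5Thm510i.lean`)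
for EVERY self-equivalence `Ψ` of the tempered Frobenioid over `B^temp(Π^tp_X)⁰`: abc-iut-L2-d4's model-case closer
`preservesIsoClasses_of_model` ([FrdI] Thm. 5.1 (iii), Thm. 3.4 (ii), Def. 1.3 (iii)(d) discharged by layer L1) with its three
object-level inputs DISCHARGED here — `hFT` («`A_N` Frobenius-trivial»: the root datum, `NthRoot.αData.isFrobeniusTrivial`),
`hΨFT` (`hΨFT_ofConnectedTemperoidData`) and `hbs` (`hbs_ofConnectedTemperoidData`).  Residual = the model hypotheses `hnd`/`hN`, the
ONE anabelian clause `hc` («`A_N^bs` has characteristic kernel», Prop. 2.4 class) and `hdiv` = Prop. 5.3 (vi) read at `A_N` for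
`s^⊓_N` (`β`-free; GAP G-w5d245-2).  v2 (same row).  [cite: MochizukiEtTh2009, Thm 5.10 (i) p.333–334 (PDF pp.107–108)] -/
theorem preservesIsoClasses_ofConnectedTemperoidData (hnd : IsNonDilatingOn tf.divisorMonoid)
    (hN : ∃ A : (BiKummerSetting.mkOfConnectedTemperoid X tf hZ hP NH A₀ hA₀ hA₀').C,
      ¬ (PreFrobenioidData.ofModel tf.divisorMonoid tf.ratFnFunctor tf.divBNatTrans).IsGroupLikeObj A)
    (hc : IsTopCharacteristic X.Pi
      ((BiKummerSetting.mkOfConnectedTemperoid X tf hZ hP NH A₀ hA₀ hA₀').galoisSurj R.AN.base R.αData.isGalois).ker)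
    (Ψ : (BiKummerSetting.mkOfConnectedTemperoid X tf hZ hP NH A₀ hA₀ hA₀').C ≌
      (BiKummerSetting.mkOfConnectedTemperoid X tf hZ hP NH A₀ hA₀ hA₀').C)
    (hdiv : ∀ α : Ψ.functor.obj (ofConnectedTemperoidData h Q odd_l R ιX K' constEmb constEmb_injective hinvc hinvp).AN ≅
        (ofConnectedTemperoidData h Q odd_l R ιX K' constEmb constEmb_injective hinvc hinvp).AN,
      ∃ ε : Aut (ofConnectedTemperoidData h Q odd_l R ιX K' constEmb constEmb_injective hinvc hinvp).AN,
        (ofConnectedTemperoidData h Q odd_l R ιX K' constEmb constEmb_injective hinvc hinvp).pre.div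
            (α.inv ≫ Ψ.functor.map (ofConnectedTemperoidData h Q odd_l R ιX K' constEmb constEmb_injective hinvc hinvp).sCap) =
          (ofConnectedTemperoidData h Q odd_l R ιX K' constEmb constEmb_injective hinvc hinvp).pre.div
            (ε.hom ≫ (ofConnectedTemperoidData h Q odd_l R ιX K' constEmb constEmb_injective hinvc hinvp).sCap)) :
    (ofConnectedTemperoidData h Q odd_l R ιX K' constEmb constEmb_injective hinvc hinvp).PreservesIsoClasses Ψ :=
  preservesIsoClasses_of_model (𝔉 := ofConnectedTemperoidData h Q odd_l R ιX K' constEmb constEmb_injective hinvc hinvp) Ψ rfl h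
    QuasiTemperoid.BTempConnected.connectedPart_isOfFSMType
    ((PreFrobenioidData.ofFunctor_isFrobeniusTrivial _ _).mpr R.αData.isFrobeniusTrivial)
    (hΨFT_ofConnectedTemperoidData h Q odd_l R ιX K' constEmb constEmb_injective hinvc hinvp hnd hN Ψ)
    (hbs_ofConnectedTemperoidData h Q odd_l R ιX K' constEmb constEmb_injective hinvc hinvp hnd hN hc Ψ) hdiv

end ConnectedTemperoidData

end ThetaFrobenioid

end Literature.AnabelianGeometry.EtaleTheta

end
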